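import Literature.NumberTheory.Transcendental.CalegariDimitrovTangSymmetrization
import Literature.NumberTheory.Transcendental.CalegariDimitrovTangL2Chi3Proofs
import Mathlib.Tactic
import HarnessLib

/-!
# The printed expansion `G_A(y) = 2 − 27y + 1014y² − 49536y³ + ⋯` (CDT Definition 125)

Calegari–Dimitrov–Tang, arXiv:2408.15403, §11.2 Definition 125 (p. 102): with `y = x + x/(x−1)`,
`G_A(y) = Sym⁺ H_A = H_A(x) + H_A(x/(x−1)) ∈ ℤ⟦y⟧`, and "Note that
`G_A(y) = 2 − 27y + 1014y² − 49536y³ + …`". With the symmetrised coefficients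
`B_n = Σ_{k=n}^{2n} a_k [yⁿ]P_k` of `CalegariDimitrovTangSymmetrization` (CDT Lemma 109) and
Zagier's `a_n = Σ_k C(n,k)² C(2k,k)` (`1, 3, 15, 93, 639, 4653, 35169, …`) this file checks the
four printed coefficients: a cross-check of the formal symmetrisation against the source.

* `CalegariDimitrovTang.zagierC_four/five/six` — `a₄ = 639`, `a₅ = 4653`, `a₆ = 35169`.
* `CalegariDimitrovTang.symPoly_two … symPoly_six` — `P₂ = y² − 2y`, …,
  `P₆ = y⁶ − 6y⁵ + 9y⁴ − 2y³`.
* `CalegariDimitrovTang.symCoeff_zagierC` — **`(B₀, B₁, B₂, B₃) = (2, −27, 1014, −49536)`**.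

No named facts.

## References

* [CalegariDimitrovTang2024] arXiv:2408.15403, §11.2 Definition 125 (p. 102); §9 Lemma 109.
-/

noncomputable section

open Polynomial Finset

namespace Literature.NumberTheory.Transcendental

namespace CalegariDimitrovTang

/-- `a₄ = 639`. [cite: CalegariDimitrovTang2024, §11.1 Lemma 121 (sequence C)] -/
theorem zagierC_four : zagierC 4 = 639 := by
  decide

/-- `a₅ = 4653`. [cite: CalegariDimitrovTang2024, §11.1 Lemma 121 (sequence C)] -/
theorem zagierC_five : zagierC 5 = 4653 := by
  decide

/-- `a₆ = 35169`. [cite: CalegariDimitrovTang2024, §11.1 Lemma 121 (sequence C)] -/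
theorem zagierC_six : zagierC 6 = 35169 := by
  decide

/-- `P₂ = y² − 2y`. [cite: CalegariDimitrovTang2024, §9 proof of Lemma 109 (p. 93)] -/
theorem symPoly_two : symPoly 2 = X ^ 2 - 2 * X := by
  rw [symPoly_add_two, symPoly_one, symPoly_zero]; ring

/-- `P₃ = y³ − 3y²`. [cite: CalegariDimitrovTang2024, §9 proof of Lemma 109 (p. 93)] -/
theorem symPoly_three : symPoly 3 = X ^ 3 - 3 * X ^ 2 := by
  rw [symPoly_add_two, symPoly_two, symPoly_one]; ring

/-- `P₄ = y⁴ − 4y³ + 2y²`. [cite: CalegariDimitrovTang2024, §9 proof of Lemma 109 (p. 93)] -/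
theorem symPoly_four : symPoly 4 = X ^ 4 - 4 * X ^ 3 + 2 * X ^ 2 := by
  rw [symPoly_add_two, symPoly_three, symPoly_two]; ring

/-- `P₅ = y⁵ − 5y⁴ + 5y³`. [cite: CalegariDimitrovTang2024, §9 proof of Lemma 109 (p. 93)] -/
theorem symPoly_five : symPoly 5 = X ^ 5 - 5 * X ^ 4 + 5 * X ^ 3 := by
  rw [symPoly_add_two, symPoly_four, symPoly_three]; ring

/-- `P₆ = y⁶ − 6y⁵ + 9y⁴ − 2y³`. [cite: CalegariDimitrovTang2024, §9 proof of Lemma 109 (p. 93)] -/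
theorem symPoly_six : symPoly 6 = X ^ 6 - 6 * X ^ 5 + 9 * X ^ 4 - 2 * X ^ 3 := by
  rw [symPoly_add_two, symPoly_five, symPoly_four]; ring

/-- **The printed expansion of `G_A(y) = Sym⁺ H_A`**: `B₀ = 2`, `B₁ = −27`, `B₂ = 1014`,
`B₃ = −49536`, i.e. `G_A(y) = 2 − 27y + 1014y² − 49536y³ + ⋯`.
[cite: CalegariDimitrovTang2024, §11.2 Definition 125: "Note that G_A(y) = 2 − 27y + 1014y² − 49536y³ + …" (p. 102)] -/
theorem symCoeff_zagierC :
    symCoeff (fun n => (zagierC n : ℚ)) 0 = 2 ∧ symCoeff (fun n => (zagierC n : ℚ)) 1 = -27 ∧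
      symCoeff (fun n => (zagierC n : ℚ)) 2 = 1014 ∧
      symCoeff (fun n => (zagierC n : ℚ)) 3 = -49536 := by
  have c11 : (symPoly 1).coeff 1 = 1 := by rw [symPoly_one]; simp
  have c21 : (symPoly 2).coeff 1 = -2 := by rw [symPoly_two]; simp [coeff_X_pow, coeff_X]
  have c22 : (symPoly 2).coeff 2 = 1 := by rw [symPoly_two]; simp [coeff_X_pow, coeff_X]
  have c32 : (symPoly 3).coeff 2 = -3 := by rw [symPoly_three]; simp [coeff_X_pow]
  have c33 : (symPoly 3).coeff 3 = 1 := by rw [symPoly_three]; simp [coeff_X_pow]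
  have c42 : (symPoly 4).coeff 2 = 2 := by rw [symPoly_four]; simp [coeff_X_pow]
  have c43 : (symPoly 4).coeff 3 = -4 := by rw [symPoly_four]; simp [coeff_X_pow]
  have c53 : (symPoly 5).coeff 3 = 5 := by rw [symPoly_five]; simp [coeff_X_pow]
  have c63 : (symPoly 6).coeff 3 = -2 := by rw [symPoly_six]; simp [coeff_X_pow]
  refine ⟨?_, ?_, ?_, ?_⟩
  · simp [symCoeff, zagierC_zero]
  · rw [symCoeff, show Icc 1 (2 * 1) = {1, 2} from rfl, Finset.sum_pair (by norm_num)]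
    simp only [c11, c21, zagierC_one, zagierC_two]
    norm_num
  · rw [symCoeff, show Icc 2 (2 * 2) = {2, 3, 4} from rfl]
    rw [Finset.sum_insert (by decide), Finset.sum_pair (by norm_num)]
    simp only [c22, c32, c42, zagierC_two, zagierC_three, zagierC_four]
    norm_num
  · rw [symCoeff, show Icc 3 (2 * 3) = {3, 4, 5, 6} from rfl]
    rw [Finset.sum_insert (by decide), Finset.sum_insert (by decide), Finset.sum_pair (by norm_num)]
    simp only [c33, c43, c53, c63, zagierC_three, zagierC_four, zagierC_five, zagierC_six]
    norm_num

end CalegariDimitrovTang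

end Literature.NumberTheory.Transcendental
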